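import Mathlib
import Literature.Analysis.FluidPDE.Axisymmetric
import Literature.Analysis.FluidPDE.AxisymmetricNoSwirlGlobalHolds
import Literature.Analysis.FluidPDE.ClassicalSobolevUniqueness
import Literature.Analysis.FluidPDE.TaoLocalisationHolds
import Summits.NavierStokesRegularity.NavierStokesRegularity.Theorems.PlaneEnergyCeilingPlanarEnergyAPrioriClosedSlab

/-!
# Route PlaneEnergyCeiling · crux `PlanarEnergyAPriori` — the axisymmetric swirl-free corner

Helper file for the crux item stmt-NavierStokesRegularity-16855 (`PlanarEnergyAPriori`, route
`PlaneEnergyCeiling`), landed `--supports` that item: the calibration corner A-S8 of the strategist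
census (gen 1). THE CRUX HOLDS FOR AXISYMMETRIC DATA WITHOUT SWIRL: along every classical solution
of unforced Navier–Stokes on `ℝ³ × [0,T)` that is Leray–Hopf from a rapidly decaying datum which is
axisymmetric and swirl-free, the planar kinetic energies are bounded uniformly in `t < T`, the
direction and the offset (`planarCeiling_of_axisymmetric_noSwirl`).

Proof: the discharged global regularity of axisymmetric swirl-free flows
(`axisymmetric_no_swirl_global_regularity_holds`: Ladyzhenskaya 1968, Ukhovskii–Yudovich 1968,
Lemarié-Rieusset 2016 Thm. 10.4) gives a global classical solution `u'` of bounded energy from the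
same datum; on every closed slab `[0,t] ⊂ [0,T)` both `u` and `u'` have all Sobolev norms bounded
(discharged `tao2011_hasBoundedSobolevNormsOn_holds`), so they agree there (discharged
Majda–Bertozzi Cor. 3.1, `IsClassicalNSSolutionOn.velocity_eq_of_hasBoundedSobolevNormsOn`);
hence `u` extends smoothly past `T`, and the landed `planarCeiling_of_hasSmoothExtensionPast`
(seat 1, `…ClosedSlab.lean`) gives the ceiling. Folklore assembly of accepted facts.
-/

noncomputable section

-- single-conjunct summit: `Summit.<Summit>.<Problem>` repeats the name by the D-0017 layout
set_option linter.dupNamespace false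

namespace Summit.NavierStokesRegularity.NavierStokesRegularity.Theorems.PlanarEnergyAPriori

open MeasureTheory Set Filter Topology Function WithLp
open scoped ENNReal NNReal
open Literature.Analysis.FluidPDE

variable {ν T : ℝ} {u : ℝ → EuclideanSpace ℝ (Fin 3) → EuclideanSpace ℝ (Fin 3)} {p : ℝ → EuclideanSpace ℝ (Fin 3) → ℝ}

/-- **A classical Leray–Hopf solution from an axisymmetric swirl-free rapidly decaying datum
extends smoothly past every `T`** (it is the restriction of the global Ladyzhenskaya–
Ukhovskii–Yudovich solution, by Sobolev-class uniqueness on closed slabs). [folklore] -/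
theorem hasSmoothExtensionPast_of_axisymmetric_noSwirl (hν : 0 < ν) (hT : 0 < T)
    (hcl : IsClassicalNSSolutionOn (Ico 0 T) ν 0 u p) (hLH : IsLerayHopfOn T ν 0 (u 0) u)
    (hdec : HasRapidSpatialDecay (u 0)) (haxi : IsAxisymmetric (u 0)) (hsw : HasNoSwirl (u 0)) :
    HasSmoothExtensionPast ν 0 u T := by
  have h0T : (0 : ℝ) ∈ Ico 0 T := ⟨le_rfl, hT⟩
  -- the global classical solution from the same datum
  obtain ⟨u', p', hcl', h0', hbdd, -⟩ := axisymmetric_no_swirl_global_regularity_holds ν hν (u 0)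
    (hcl.contDiff_velocity h0T) (hcl.divFree 0 h0T) hdec haxi hsw
  have hdec' : HasRapidSpatialDecay (u' 0) := by rw [h0']; exact hdec
  -- agreement on `[0,T)`: Sobolev-class uniqueness on every closed slab `[0,t]`
  have hagree : ∀ t ∈ Ico 0 T, u' t = u t := by
    intro t ht
    rcases eq_or_lt_of_le ht.1 with h | htpos
    · subst h; exact h0'
    have hclu : IsClassicalNSSolutionOn (Icc 0 t) ν 0 u p :=
      hcl.mono (Icc_subset_Ico_right ht.2) (uniqueDiffOn_Icc htpos)
    have hclu' : IsClassicalNSSolutionOn (Icc 0 t) ν 0 u' p' :=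
      hcl'.mono Icc_subset_Ici_self (uniqueDiffOn_Icc htpos)
    have hEu : ∃ C : ℝ≥0, ∀ s ∈ Icc 0 t, ∫⁻ x, ‖u s x‖ₑ ^ 2 ≤ C :=
      ⟨(2 * VectorCalculus.kineticEnergy (u 0)).toNNReal, fun s hs =>
        hLH.lintegral_enorm_sq_le hν.le ⟨hs.1, hs.2.trans ht.2.le⟩⟩
    have hEu' : ∃ C : ℝ≥0, ∀ s ∈ Icc 0 t, ∫⁻ x, ‖u' s x‖ₑ ^ 2 ≤ C := by
      obtain ⟨C, hCtop, hC⟩ := hbdd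
      exact ⟨C.toNNReal, fun s hs => (hC s hs.1).trans (ENNReal.coe_toNNReal hCtop.ne).ge⟩
    have hBu : HasBoundedSobolevNormsOn (Icc 0 t) u := tao2011_hasBoundedSobolevNormsOn_holds hν htpos hclu hEu hdec
    have hBu' : HasBoundedSobolevNormsOn (Icc 0 t) u' :=
      tao2011_hasBoundedSobolevNormsOn_holds hν htpos hclu' hEu' hdec'
    exact hclu'.velocity_eq_of_hasBoundedSobolevNormsOn hclu hν.le htpos hBu' hBu h0' t ⟨ht.1, le_rfl⟩
  exact ⟨T + 1, by linarith, u', p', hcl'.mono Ico_subset_Ici_self (uniqueDiffOn_Ico 0 (T + 1)), hagree⟩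

/-- **THE CRUX IN THE AXISYMMETRIC SWIRL-FREE CORNER.** Along every classical solution of unforced
Navier–Stokes on `ℝ³ × [0,T)` (`ν, T > 0`) that is Leray–Hopf from a rapidly decaying datum which is
axisymmetric without swirl, the planar kinetic energies `∫_{R{x₂=c}} |u(t)|² dA` are bounded uniformly
in `t < T`, `R`, `c`. [folklore] -/
theorem planarCeiling_of_axisymmetric_noSwirl (hν : 0 < ν) (hT : 0 < T)
    (hcl : IsClassicalNSSolutionOn (Ico 0 T) ν 0 u p) (hLH : IsLerayHopfOn T ν 0 (u 0) u)
    (hdec : HasRapidSpatialDecay (u 0)) (haxi : IsAxisymmetric (u 0)) (hsw : HasNoSwirl (u 0)) :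
    ∃ M : ℝ, ∀ t ∈ Ico 0 T, ∀ (R : EuclideanSpace ℝ (Fin 3) ≃ₗᵢ[ℝ] EuclideanSpace ℝ (Fin 3)) (c : ℝ),
      ∫⁻ y : EuclideanSpace ℝ (Fin 2), ‖u t (R (toLp 2 ![y 0, y 1, c]))‖ₑ ^ 2 ≤ ENNReal.ofReal M :=
  planarCeiling_of_hasSmoothExtensionPast hν hT hcl hLH hdec
    (hasSmoothExtensionPast_of_axisymmetric_noSwirl hν hT hcl hLH hdec haxi hsw)

/-- **The crux in the axisymmetric swirl-free corner, registered closed form** (sub-goal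
`planarCeiling_of_axisymmetric_noSwirl_closedForm` of stmt-NavierStokesRegularity-16855).
[folklore] -/
theorem planarCeiling_of_axisymmetric_noSwirl_closedForm : ∀ (ν T : ℝ), 0 < ν → 0 < T → ∀ (u : ℝ → EuclideanSpace ℝ (Fin 3) → EuclideanSpace ℝ (Fin 3)) (p : ℝ → EuclideanSpace ℝ (Fin 3) → ℝ), Literature.Analysis.FluidPDE.IsClassicalNSSolutionOn (Set.Ico 0 T) ν 0 u p → Literature.Analysis.FluidPDE.IsLerayHopfOn T ν 0 (u 0) u → Literature.Analysis.FluidPDE.HasRapidSpatialDecay (u 0) → Literature.Analysis.FluidPDE.IsAxisymmetric (u 0) → Literature.Analysis.FluidPDE.HasNoSwirl (u 0) → ∃ M : ℝ, ∀ t ∈ Set.Ico 0 T, ∀ (R : EuclideanSpace ℝ (Fin 3) ≃ₗᵢ[ℝ] EuclideanSpace ℝ (Fin 3)) (c : ℝ), ∫⁻ y : EuclideanSpace ℝ (Fin 2), ‖u t (R (WithLp.toLp 2 ![y 0, y 1, c]))‖ₑ ^ 2 ≤ ENNReal.ofReal M :=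
  fun _ _ hν hT _ _ hcl hLH hdec haxi hsw => planarCeiling_of_axisymmetric_noSwirl hν hT hcl hLH hdec haxi hsw

end Summit.NavierStokesRegularity.NavierStokesRegularity.Theorems.PlanarEnergyAPriori

end
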